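import Summits.NavierStokesRegularity.NavierStokesRegularity.Theorems.TypeICertificateLadderTargetRotatingConjugateDensityKato
import Literature.Analysis.FluidPDE.PineauVicolWeightBounds
import HarnessLib

/-!
# The `w`- and `v`-equations and the a priori sub-Gaussian decay, rotating gauge
# (tools for the rotating conjugate density, stub B2 of line `killing-twisted-bernoulli-solitons`,
# crux `Target`, stmt-NavierStokesRegularity-1217)

Helper file (all results proved, no definitions, no named facts). Rotating-gauge version of the
first part of the tree's `PineauVicolWeightBounds` (Pineau–Vicol 2026, Prop. 5.1, Lemma 5.4,
arXiv:2607.09619), drift `X₀ = ½y + U′`, `U′ = U − J` (`DriftHyp U C₀`, `J` skew linear):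

* `w_equation_rot`: for `w = γ v` with `N v = 0`, `Δw + Dw[U′ + ½y] + (n/2) w = 0`;
* `v_equation_rot`: `−Δv + Dv[½y − U′] + ½⟪U′, y⟫ v = 0` (and `⟪U′y, y⟫ = ⟪Uy, y⟫`);
* `decay_rot`: for a positive smooth solution with `v ∈ L²(γ)` and `ε > ½`,
  `v(y) e^{−ε|y|²/4} → 0` as `|y| → ∞`. The tree's proof (Harnack mean-value bound + Gaussian
  weight on the ball + `∫γv² < ∞`) at the scale `λ = 1/(C₀ + (½ + ‖J‖)(|y| + 2) + 6)` adapted to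
  the linear growth `|U′ x| ≤ C₀ + ‖J‖|x|` of the drift; the loss `λ⁻ⁿ ≤ e^{n/λ}` is still
  `e^{O(|y|)}` and is absorbed by the Gaussian gain `e^{−(2ε−1)|y|²/8}`.

References: B. Pineau, V. Vicol, arXiv:2607.09619 (2026), Prop. 5.1, Lemma 5.4;
G. M. Lieberman, *Second order parabolic differential equations* (1996), Thm. 6.27.
-/

noncomputable section

open MeasureTheory TopologicalSpace Set Function Filter Topology InnerProductSpace Real
open scoped RealInnerProductSpace ENNReal NNReal ContDiff Distributions

namespace Summit.NavierStokesRegularity.NavierStokesRegularity.Theorems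

open Literature.Analysis.FluidPDE Literature.Analysis.FluidPDE.PineauVicol2026
open scoped Laplacian

variable {E : Type} [NormedAddCommGroup E] [InnerProductSpace ℝ E] [FiniteDimensional ℝ E]
  [MeasurableSpace E] [BorelSpace E]

variable {U : E → E} {C₀ : ℝ}

omit [MeasurableSpace E] [BorelSpace E] in
/-- **The `w`-equation, rotating gauge**: for `w = γ v` with `N v = 0` (drift `½y + (U − J)`),
`Δw + Dw[(U − J) + ½y] + (n/2) w = 0` (`L*_J w = 0`). [cite: PineauVicol2026, (5.1)–(5.2)] -/
theorem w_equation_rot (h : DriftHyp U C₀) {J : E →L[ℝ] E} (hJ : ∀ v, ⟪J v, v⟫ = 0) {v : E → ℝ}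
    (hv : ContDiff ℝ 2 v) (hN : ∀ y, adjN (fun z : E => (1 / 2 : ℝ) • z + (U z - J z)) v y = 0) (y : E) :
    (Δ (fun z => gaussWeight z * v z)) y +
      fderiv ℝ (fun z => gaussWeight z * v z) y ((U y - J y) + (1 / 2 : ℝ) • y) +
      Module.finrank ℝ E / 2 * (gaussWeight y * v y) = 0 := by
  haveI : CompleteSpace E := FiniteDimensional.complete ℝ E
  have hU'1 : ContDiff ℝ 1 (fun z : E => U z - J z) := (h.contDiff.sub J.contDiff).of_le (mod_cast le_top)
  have e := hN y
  unfold adjN at e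
  have hθd : DifferentiableAt ℝ (fun z => gaussWeight z * v z) y :=
    ((contDiff_gaussWeight.mul hv).differentiable (by norm_num)) y
  have hXd : DifferentiableAt ℝ (fun z : E => (1 / 2 : ℝ) • z + (U z - J z)) y :=
    ((differentiableAt_id).const_smul (1 / 2 : ℝ)).add (hU'1.differentiable one_ne_zero y)
  rw [divergence_smul_apply (θ := fun z => gaussWeight z * v z) (u := fun z : E => (1 / 2 : ℝ) • z + (U z - J z)) hθd hXd,
    divergence_half_add (U := fun z : E => U z - J z) (hU'1.differentiable one_ne_zero),
    divergence_sub_skew_eq_zero h hJ, real_inner_comm, inner_gradient_left, add_comm ((1 / 2 : ℝ) • y)] at e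
  linarith

omit [MeasurableSpace E] [BorelSpace E] in
/-- **The `v`-equation, rotating gauge** (non-divergence form):
`−Δv + Dv[½y − (U − J)] + ½⟪(U − J) y, y⟫ v = 0`. [folklore] -/
theorem v_equation_rot (h : DriftHyp U C₀) {J : E →L[ℝ] E} (hJ : ∀ v, ⟪J v, v⟫ = 0) {v : E → ℝ}
    (hv : ContDiff ℝ 2 v) (hN : ∀ y, adjN (fun z : E => (1 / 2 : ℝ) • z + (U z - J z)) v y = 0) (y : E) :
    -(Δ v) y + fderiv ℝ v y ((1 / 2 : ℝ) • y - (U y - J y)) + ⟪U y - J y, y⟫ / 2 * v y = 0 := by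
  have hU'1 : ContDiff ℝ 1 (fun z : E => U z - J z) := (h.contDiff.sub J.contDiff).of_le (mod_cast le_top)
  have e := hN y
  rw [adjN_eq_neg_mul hv hU'1 y, divergence_sub_skew_eq_zero h hJ y, sub_zero, neg_eq_zero] at e
  rcases mul_eq_zero.1 e with h0 | h0
  · exact absurd h0 (gaussWeight_pos y).ne'
  · exact h0

/-- **A priori sub-Gaussian decay, rotating gauge.** For a positive smooth solution `v` of
`N v = 0` (drift `½y + (U − J)`) with `v ∈ L²(γ)` and `ε > ½`, `v(y) e^{−ε|y|²/4} → 0` as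
`|y| → ∞`. [folklore] -/
theorem decay_rot (h : DriftHyp U C₀) {J : E →L[ℝ] E} (hJ : ∀ v, ⟪J v, v⟫ = 0) {v : E → ℝ}
    (hv : ContDiff ℝ ∞ v) (hvpos : ∀ y, 0 < v y) (hv2 : MemLp v 2 (gaussMeasure (E := E)))
    (hN : ∀ y, adjN (fun z : E => (1 / 2 : ℝ) • z + (U z - J z)) v y = 0) {ε : ℝ} (hε : 1 / 2 < ε)
    {η : ℝ} (hη : 0 < η) :
    ∃ R₀ : ℝ, ∀ y, R₀ ≤ ‖y‖ → v y * gaussProfile (-(ε / 4)) y ≤ η := by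
  haveI : CompleteSpace E := FiniteDimensional.complete ℝ E
  set n := Module.finrank ℝ E with hn
  have hC₀ := h.nonneg
  set A : ℝ := ‖J‖ with hAdef
  have hA0 : 0 ≤ A := norm_nonneg _
  have hUJ : ∀ x, ‖U x - J x‖ ≤ C₀ + A * ‖x‖ := fun x => hAdef ▸ norm_sub_skew_le h J x
  clear_value A
  -- the `w`-equation
  set w : E → ℝ := fun z => gaussWeight z * v z with hw
  have hws : ContDiff ℝ ∞ w := contDiff_gaussWeight.mul hv
  have hwpos : ∀ x, 0 < w x := fun x => mul_pos (gaussWeight_pos x) (hvpos x)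
  have hweq : ∀ x, (Δ w) x + fderiv ℝ w x ((U x - J x) + (1 / 2 : ℝ) • x) + n / 2 * w x = 0 :=
    w_equation_rot h hJ (hv.of_le (by norm_cast)) hN
  have hβ : Continuous fun x : E => (U x - J x) + (1 / 2 : ℝ) • x :=
    (h.continuous.sub J.continuous).add (continuous_id.const_smul _)
  -- constants
  set S : ℝ := ∫ y, gaussWeight y * v y ^ 2 with hS
  have hS0 : 0 ≤ S := integral_nonneg fun y => mul_nonneg (gaussWeight_pos y).le (sq_nonneg _)
  set V₁ : ℝ := (volume (Metric.ball (0 : E) 1)).toReal with hV₁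
  have hV₁pos : 0 < V₁ := ENNReal.toReal_pos (Metric.measure_ball_pos volume (0 : E) one_pos).ne' measure_ball_lt_top.ne
  set C := harnackConst E with hC
  have hCpos : 0 < C := harnackConst_pos
  clear_value S C V₁
  set K : ℝ := C / 2 * (1 + S / V₁) with hK
  have hKpos : 0 < K := mul_pos (div_pos hCpos two_pos) (by positivity)
  clear_value K
  obtain ⟨R₁, hR₁0, hR₁⟩ := exists_exp_quadratic_le (a := (2 * ε - 1) / 8) (by linarith) (1 / 4 + n * (1 / 2 + A))
    (n * (C₀ + 7 + 2 * A) - 1 / 8) (η := η / K) (by positivity)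
  refine ⟨max 1 R₁, fun y hy => ?_⟩
  have hy1 : 1 ≤ ‖y‖ := (le_max_left _ _).trans hy
  have hyR : R₁ ≤ ‖y‖ := (le_max_right _ _).trans hy
  -- the scale
  set lam : ℝ := 1 / (C₀ + (1 / 2 + A) * (‖y‖ + 2) + 6) with hlam
  have hden : 0 < C₀ + (1 / 2 + A) * (‖y‖ + 2) + 6 := by positivity
  have hlampos : 0 < lam := by positivity
  have hlam1 : lam ≤ 1 / 6 := one_div_le_one_div_of_le (by norm_num) (by nlinarith [norm_nonneg y])
  have hbd : ∀ x ∈ Metric.ball y (9 * lam), lam * ‖(U x - J x) + (1 / 2 : ℝ) • x‖ ≤ 1 := by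
    intro x hx
    rw [Metric.mem_ball, dist_eq_norm] at hx
    have hxn : ‖x‖ ≤ ‖y‖ + 2 := by
      have := norm_le_norm_add_norm_sub' x y
      nlinarith
    have hb : ‖(U x - J x) + (1 / 2 : ℝ) • x‖ ≤ C₀ + (1 / 2 + A) * (‖y‖ + 2) := by
      calc ‖(U x - J x) + (1 / 2 : ℝ) • x‖ ≤ ‖U x - J x‖ + ‖(1 / 2 : ℝ) • x‖ := norm_add_le _ _
        _ ≤ (C₀ + A * ‖x‖) + (1 / 2) * ‖x‖ := by
            rw [norm_smul, Real.norm_eq_abs, abs_of_pos (by norm_num : (0:ℝ) < 1 / 2)]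
            exact add_le_add (hUJ x) le_rfl
        _ ≤ C₀ + (1 / 2 + A) * (‖y‖ + 2) := by nlinarith
    rw [hlam, div_mul_eq_mul_div, one_mul, div_le_one hden]
    linarith
  -- Harnack mean value
  have hmean := harnack_mean hws hwpos hβ (by positivity : (0 : ℝ) ≤ n / 2) hweq hlampos hbd
  rw [← hC] at hmean
  -- the Gaussian on the ball
  set T : ℝ := Real.exp (-(‖y‖ - 1) ^ 2 / 8) with hT
  have hTpos : 0 < T := Real.exp_pos _
  clear_value T
  have hγB : ∀ x ∈ Metric.ball y lam, gaussWeight x ≤ T ^ 2 := by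
    intro x hx
    rw [Metric.mem_ball, dist_eq_norm] at hx
    have hxn : ‖y‖ - 1 ≤ ‖x‖ := by
      have := norm_sub_norm_le y x
      rw [norm_sub_rev] at this
      linarith
    rw [hT, ← Real.exp_nat_mul, gaussWeight]
    apply Real.exp_le_exp.2
    push_cast
    have : (‖y‖ - 1) ^ 2 ≤ ‖x‖ ^ 2 := by nlinarith [norm_nonneg x]
    linarith
  -- `∫_B w ≤ ½ T (|B| + S)`
  have hvolfin : volume (Metric.ball y lam) < ⊤ := measure_ball_lt_top
  have hvol : (volume (Metric.ball y lam)).toReal = lam ^ n * V₁ := by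
    rw [hV₁, hn, Measure.addHaar_ball_of_pos volume y hlampos, ENNReal.toReal_mul,
      ENNReal.toReal_ofReal (by positivity)]
  have hvolpos : 0 < (volume (Metric.ball y lam)).toReal := by rw [hvol]; positivity
  have hT1 : T ≤ 1 := by
    rw [hT]; apply Real.exp_le_one_iff.2
    have := sq_nonneg (‖y‖ - 1); apply div_nonpos_of_nonpos_of_nonneg <;> linarith
  have hint : ∫ x in Metric.ball y lam, w x ≤ (1 / 2) * (T * ((volume (Metric.ball y lam)).toReal + S)) := by
    have i1 : IntegrableOn (fun x => gaussWeight x * v x ^ 2) (Metric.ball y lam) :=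
      (integrable_gaussWeight_mul_sq_of_memLp hv2).integrableOn
    have i2 : IntegrableOn (fun _ : E => T) (Metric.ball y lam) := integrableOn_const hvolfin.ne
    have hpt : ∀ x ∈ Metric.ball y lam, w x ≤ (1 / 2) * (T + T * (gaussWeight x * v x ^ 2)) := by
      intro x hx
      have hg := (gaussWeight_pos x).le
      have hγT := hγB x hx
      have h1 : gaussWeight x * v x ≤ (1 / 2) * (gaussWeight x / T + T * (gaussWeight x * v x ^ 2)) := by
        have hsq : 0 ≤ gaussWeight x / T * (1 - T * v x) ^ 2 := by positivity
        have e : (1 / 2) * (gaussWeight x / T + T * (gaussWeight x * v x ^ 2)) - gaussWeight x * v x =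
            (1 / 2) * (gaussWeight x / T * (1 - T * v x) ^ 2) := by field_simp; ring
        linarith [hsq, e]
      have h2 : gaussWeight x / T ≤ T := by rw [div_le_iff₀ hTpos, ← pow_two]; exact hγT
      show gaussWeight x * v x ≤ _
      have h3 : (1 / 2) * (gaussWeight x / T + T * (gaussWeight x * v x ^ 2)) ≤ (1 / 2) * (T + T * (gaussWeight x * v x ^ 2)) := by
        linarith
      exact h1.trans h3
    calc ∫ x in Metric.ball y lam, w x ≤ ∫ x in Metric.ball y lam, (1 / 2) * (T + T * (gaussWeight x * v x ^ 2)) := by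
          refine setIntegral_mono_on ?_ ((i2.add (i1.const_mul _)).const_mul _) measurableSet_ball hpt
          exact (hws.continuous.continuousOn.integrableOn_compact (isCompact_closedBall y lam)).mono_set
            Metric.ball_subset_closedBall
      _ = (1 / 2) * (T * (volume (Metric.ball y lam)).toReal + T * ∫ x in Metric.ball y lam, gaussWeight x * v x ^ 2) := by
          rw [integral_const_mul, integral_add i2 (i1.const_mul _), integral_const_mul, setIntegral_const, smul_eq_mul,
            mul_comm _ T]
          rfl
      _ ≤ (1 / 2) * (T * ((volume (Metric.ball y lam)).toReal + S)) := by
          have : ∫ x in Metric.ball y lam, gaussWeight x * v x ^ 2 ≤ S :=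
            hS ▸ setIntegral_le_integral (integrable_gaussWeight_mul_sq_of_memLp hv2)
              (Eventually.of_forall fun x => mul_nonneg (gaussWeight_pos x).le (sq_nonneg _))
          nlinarith [hTpos]
  -- `w(y) ≤ (C/2) T (1 + S/|B|)`
  have hwy : w y ≤ C / 2 * T * (1 + S / (volume (Metric.ball y lam)).toReal) := by
    have := hmean.trans (mul_le_mul_of_nonneg_left hint hCpos.le)
    rw [← le_div_iff₀ hvolpos] at this
    refine this.trans (le_of_eq ?_)
    rw [div_eq_iff hvolpos.ne']
    field_simp
  -- `1/|B| ≤ e^{n x₀}/V₁`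
  set x₀ : ℝ := C₀ + (1 / 2 + A) * (‖y‖ + 2) + 6 with hx₀
  have hx₀0 : 0 ≤ x₀ := hden.le
  have hlaminv : 1 / lam ^ n ≤ Real.exp (n * x₀) := by
    rw [hlam, one_div_pow, one_div_one_div, Real.exp_nat_mul]
    exact pow_le_pow_left₀ hx₀0 (by linarith [Real.add_one_le_exp x₀]) n
  have hlampow : 0 < lam ^ n := by positivity
  have hSvol : S / (volume (Metric.ball y lam)).toReal ≤ S / V₁ * Real.exp (n * x₀) := by
    rw [hvol, show S / (lam ^ n * V₁) = S / V₁ * (1 / lam ^ n) by field_simp]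
    exact mul_le_mul_of_nonneg_left hlaminv (by positivity)
  have hexp1 : 1 ≤ Real.exp (n * x₀) := Real.one_le_exp (by positivity)
  have hA' : 1 + S / (volume (Metric.ball y lam)).toReal ≤ (1 + S / V₁) * Real.exp (n * x₀) := by
    have e : (1 + S / V₁) * Real.exp (n * x₀) = Real.exp (n * x₀) + S / V₁ * Real.exp (n * x₀) := by ring
    rw [e]; exact add_le_add hexp1 hSvol
  have hCT : 0 ≤ C / 2 * T := mul_nonneg (div_nonneg hCpos.le two_pos.le) hTpos.le
  have hwy1 : C / 2 * T * (1 + S / (volume (Metric.ball y lam)).toReal) ≤ C / 2 * T * ((1 + S / V₁) * Real.exp (n * x₀)) :=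
    mul_le_mul_of_nonneg_left hA' hCT
  have hKe : C / 2 * T * ((1 + S / V₁) * Real.exp (n * x₀)) = K * (T * Real.exp (n * x₀)) := by
    simp only [hK]; ring
  have hwy2 : w y ≤ K * (T * Real.exp (n * x₀)) := hKe ▸ hwy.trans hwy1
  -- conclude
  have hφ : v y * gaussProfile (-(ε / 4)) y = w y * Real.exp ((1 - ε) * ‖y‖ ^ 2 / 4) := by
    simp only [hw, gaussProfile, gaussWeight]
    rw [mul_comm (Real.exp _) (v y), mul_assoc, ← Real.exp_add]
    congr 2; ring
  rw [hφ]
  have hE : T * Real.exp (n * x₀) * Real.exp ((1 - ε) * ‖y‖ ^ 2 / 4) =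
      Real.exp (-((2 * ε - 1) / 8) * ‖y‖ ^ 2 + (1 / 4 + n * (1 / 2 + A)) * ‖y‖ + (n * (C₀ + 7 + 2 * A) - 1 / 8)) := by
    rw [hT, hx₀, ← Real.exp_add, ← Real.exp_add]; congr 1; ring
  have hfin := hR₁ ‖y‖ hyR
  calc w y * Real.exp ((1 - ε) * ‖y‖ ^ 2 / 4) ≤ K * (T * Real.exp (n * x₀)) * Real.exp ((1 - ε) * ‖y‖ ^ 2 / 4) :=
        mul_le_mul_of_nonneg_right hwy2 (Real.exp_pos _).le
    _ = K * Real.exp (-((2 * ε - 1) / 8) * ‖y‖ ^ 2 + (1 / 4 + n * (1 / 2 + A)) * ‖y‖ + (n * (C₀ + 7 + 2 * A) - 1 / 8)) := by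
        rw [← hE]; ring
    _ ≤ K * (η / K) := mul_le_mul_of_nonneg_left hfin hKpos.le
    _ = η := by field_simp

/-- **Registered form (B2 tool stub `rotatingDensity_decay`, `ℝ³`, `J = α • rotGenL`):** the a priori
sub-Gaussian decay of a positive finite-energy solution of the rotating-gauge weight equation. [folklore] -/
theorem rotatingDensity_decay :
    ∀ (U : EuclideanSpace ℝ (Fin 3) → EuclideanSpace ℝ (Fin 3)) (C₀ α : ℝ), Literature.Analysis.FluidPDE.PineauVicol2026.DriftHyp U C₀ → ∀ v : EuclideanSpace ℝ (Fin 3) → ℝ, ContDiff ℝ (⊤ : ℕ∞) v → (∀ y, 0 < v y) → MeasureTheory.MemLp v 2 (Literature.Analysis.FluidPDE.PineauVicol2026.gaussMeasure (E := EuclideanSpace ℝ (Fin 3))) → (∀ y : EuclideanSpace ℝ (Fin 3), Literature.Analysis.FluidPDE.PineauVicol2026.adjN (fun z => (1 / 2 : ℝ) • z + (U z - α • Literature.Analysis.FluidPDE.rotGen z)) v y = 0) → ∀ ε : ℝ, 1 / 2 < ε → ∀ η : ℝ, 0 < η → ∃ R₀ : ℝ, ∀ y : EuclideanSpace ℝ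 (Fin 3), R₀ ≤ ‖y‖ → v y * Literature.Analysis.FluidPDE.gaussProfile (-(ε / 4)) y ≤ η := by
  intro U C₀ α h v hv hvpos hv2 hN ε hε η hη
  have hJ : ∀ w : EuclideanSpace ℝ (Fin 3), ⟪(α • rotGenL) w, w⟫ = 0 := fun w => by
    rw [_root_.FunLike.coe_smul, Pi.smul_apply, rotGenL_apply, real_inner_smul_left, inner_rotGen_self, mul_zero]
  exact decay_rot h hJ hv hvpos hv2 hN hε hη

end Summit.NavierStokesRegularity.NavierStokesRegularity.Theorems
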